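/-
Copyright (c) 2026 the pub-hodgecm-mathlib formalisation cell (harness21).  Prover seat hodgecm-mathlib-LH4-p02 (g12): STAGE 1a «(D-RAM) FOUR-FRAME» squad of
crux H413 (director s1808; heir LEAD F0P3a-plan (g18) T17-27 DIRECTIVE b9ecbbedecc9c5ae D2 §1 item 1 ∕ D3; dealer LH4-plan (g10)), 2026-09-03:
THE (ii-0) FOUNDATION IS PAID — `WildTransitivity` of the line's law-defs leaf holds at every datum.
-/
import Summits.HodgeConjecture.HodgeConjecture.Theorems.F0P3cDyRamFourFrameLawDefs    -- №1 (dealer LH4-plan (g10)): `WildTransitivityAt`, `WildTransitivity` (prover targets over ★ `UnitaryThreeFourFrameDefs`)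
import Literature.NumberTheory.Automorphic.UnitaryLatticeTreeSelfDualTransitiveWild     -- ★ p854568 htr₀-wild (LH4-p01 (g17)): `exists_unitary_mapGL_stdLattice_eq_of_isSelfDualLattice_of_ramified`, `v_map_sub_self_lt_one_of_even`
import Literature.NumberTheory.Automorphic.UnitaryLatticeTreeTypeTwoTransitiveWild     -- ★ p854569 htr₂-wild (this seat): `forall_isVertexLattice_two_exists_mapGL_N₁_eq_of_ramified`
import HarnessLib

/-!
# (D-RAM) FOUR-FRAME, unit (ii-0): `WildTransitivity` HOLDS — `U(σ, Φ₃)` is transitive on both vertex types of the lattice graph at EVERY ramified datum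
# (Jacobowitz 1962 §§9–11; Bruhat–Tits 1972 §10)

Cell `pub/hodgecm-mathlib` (D-0151), crux H413 = `stmt-HodgeConjecture-24833`, sibling line `Cruxes/H413/Lines/F0_P3c_DyRamFourFrame.lean` (STAGE 1a, registered by write by the
dealer).  THEOREMS ONLY (no `def`, no `sorry`, no instance ∕ notation).  This file PAYS the line's unit-(ii-0) Prop `WildTransitivity` of the law-defs leaf
`Theorems/F0P3cDyRamFourFrameLawDefs.lean` (dealer LH4-plan (g10)) — `∀ (K complete, 𝓀 finite) σ ϖ d t, IsRamifiedQuadraticDatum σ ϖ d t → |2| < 1 → htr₀ ∧ htr₂` — by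
NAME, from the two ★ Literature theorems of the squad: `htr₀` = ★ `exists_unitary_mapGL_stdLattice_eq_of_isSelfDualLattice_of_ramified` (LH4-p01 (g17), p854568) and
`htr₂` = ★ `forall_isVertexLattice_two_exists_mapGL_N₁_eq_of_ramified` (LH4-p02 (g12), p854569), whose hypotheses are the datum's conjuncts (`hres` through
★ `v_map_sub_self_lt_one_of_even`, `2 ≠ 0` through `v 2 = vϖ^t`).  The fence `|2| < 1`, completeness and `d`-parity are NOT used: transitivity holds at tame, ramified-prime
and ramified-unit places alike (no second orbit).  With B-p04 (g61)'s ★-idiom bridge `wildTree_of_wildTransitivity` the tree Prop `WildTree` follows.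
HONEST LABEL: HC_CM is proved only modulo the 7 printed citations (2 remaining: hLiu418 = stmt-HodgeConjecture-24832, h413 = stmt-HodgeConjecture-24833) until rung 0 closes;
(D-RAM) `stub_DyRamCore` stays PRINT [LanglandsShelstad1989 Thm. p. 484 ∕ Rogawski1990 Prop. 4.9.1 (a)] until the road's END lands; this file moves no registry.

* `htr₂_of_isRamifiedQuadraticDatum`, **`wildTransitivityAt_holds`**, **`wildTransitivity_holds : WildTransitivity`**.
-/

noncomputable section

namespace Summit.HodgeConjecture.HodgeConjecture.Cruxes.H413.F0P3cDyRamWildTransitivity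

open scoped Valued WithZero Matrix MatrixGroups
open Literature.NumberTheory.Automorphic Literature.NumberTheory.Automorphic.HermitianLattice
  Literature.NumberTheory.Automorphic.UnitaryLatticeTree Literature.NumberTheory.Automorphic.UnitaryThreeFourFrame
  Summit.HodgeConjecture.HodgeConjecture.Cruxes.H413.F0P3cDyRamFourFrameLawDefs

/-- **`htr₂` FROM THE DATUM**: under `IsRamifiedQuadraticDatum σ ϖ d t` and a finite residue field every type-two vertex lattice of `(K³, Φ₃)` is `u • latt diag(1,1,ϖ)`,
`u ∈ U(σ, Φ₃)` — ★ `forall_isVertexLattice_two_exists_mapGL_N₁_eq_of_ramified` with `hres` from ★ `v_map_sub_self_lt_one_of_even` and `2 ≠ 0` from `v 2 = vϖ^t`.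
[cite: Jacobowitz1962, §§9–11] [cite: BruhatTits1972, §10] -/
theorem htr₂_of_isRamifiedQuadraticDatum {K : Type} [Field K] [Valued K ℤᵐ⁰] [Finite 𝓀[K]] {σ : K →+* K} {ϖ : K} {d t : ℕ}
    (hD : IsRamifiedQuadraticDatum σ ϖ d t) :
    ∀ M : Submodule 𝒪[K] (Fin 3 → K), IsVertexLattice σ ϖ ((StdForm.antidiagonal 3).over K) 2 M →
      ∃ u : unitaryGroupOfForm σ ((StdForm.antidiagonal 3).over K), M = mapGL (u : GL (Fin 3) K) (latt (Matrix.diagonal ![(1 : K), 1, ϖ])) := by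
  obtain ⟨hσ, hvσ, hϖ, heven, hd, h1d, h2t⟩ := hD
  have h20 : (2 : K) ≠ 0 := fun h2 => by
    rw [h2, map_zero] at h2t
    exact pow_ne_zero _ ((Valuation.ne_zero_iff _).2 (CartanUnique.uniformizer_ne_zero hϖ)) h2t.symm
  exact forall_isVertexLattice_two_exists_mapGL_N₁_eq_of_ramified hσ hvσ hϖ (fun x hx => v_map_sub_self_lt_one_of_even hσ hϖ heven hd h1d hx) heven h20

/-- **WILD TRANSITIVITY AT EVERY DATUM**: the law-defs leaf's `WildTransitivityAt σ ϖ d t` (datum → fence → `htr₀ ∧ htr₂`) holds — `htr₀` by ★ LH4-p01 (g17)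
`exists_unitary_mapGL_stdLattice_eq_of_isSelfDualLattice_of_ramified`, `htr₂` by `htr₂_of_isRamifiedQuadraticDatum`; the fence and completeness are unused.
[cite: Jacobowitz1962, §§9–11] [cite: BruhatTits1972, §10] -/
theorem wildTransitivityAt_holds {K : Type} [Field K] [Valued K ℤᵐ⁰] [CompleteSpace K] [Fintype 𝓀[K]] (σ : K →+* K) (ϖ : K) (d t : ℕ) :
    WildTransitivityAt σ ϖ d t := fun hD _ =>
  ⟨exists_unitary_mapGL_stdLattice_eq_of_isSelfDualLattice_of_ramified hD.1 hD.2.1 hD.2.2.1 hD.2.2.2.1 hD.2.2.2.2.1 hD.2.2.2.2.2.1 hD.2.2.2.2.2.2,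
    htr₂_of_isRamifiedQuadraticDatum hD⟩

/-- **THE (ii-0) FOUNDATION `WildTransitivity` HOLDS** (unit (ii-0) of the STAGE-1a price sheet; the line's `stub_WildTreeFoundation` input): at every complete datum with
finite residue field, `U(σ, Φ₃)` is transitive on the self-dual and on the type-two vertices of the lattice graph of `(K³, Φ₃)`. [cite: Jacobowitz1962, §§9–11] [cite: BruhatTits1972, §10] -/
theorem wildTransitivity_holds : WildTransitivity := fun σ ϖ d t => wildTransitivityAt_holds σ ϖ d t

end Summit.HodgeConjecture.HodgeConjecture.Cruxes.H413.F0P3cDyRamWildTransitivity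

end
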